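import Summits.ValiantsHypothesis.ValiantsHypothesis.Theorems.PolyaContinuedSignedCoverLittleCaseB
import Summits.ValiantsHypothesis.ValiantsHypothesis.Theorems.PolyaContinuedSignedCoverLittleCount
import Summits.ValiantsHypothesis.ValiantsHypothesis.Theorems.PolyaContinuedSignedCoverLittleTransferCircuits
import Summits.ValiantsHypothesis.ValiantsHypothesis.Theorems.PolyaContinuedSignedCoverLittleKstd
import HarnessLib

/-!
# Route PolyaContinued — support item `SignedCoverLittle` (stmt-ValiantsHypothesis-7426):
# the core — no Pfaffian source label-bijects onto `K_{3,3} ⊔ diagonal`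

Assembly of §2 of the paper proof `proof-LabelTransfer.md` in NORMAL FORM, from the section
files: (F1) `…TransferCircuits.lean`, (CS) `…Count.lean`, (EAR) `…EarC/EarD.lean`,
(EAR)→(EVEN) `…CaseB.lean` (with `…Even.lean`), and the target facts `…Kstd.lean`.

* `not_isPfaffianBipartite_of_labelIdentity_of_shape` — let `H ⊇ diagonal`, `φ (i, i) = (i, i)`,
  and let the label identity hold onto a target of SHAPE `E_A = {(x, y) : x, y ∈ A} ∪ diagonal`
  with `#A = 3` (`K_{3,3}` on the rows/columns `A` plus the diagonal matching elsewhere). Then `H`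
  is NOT Pfaffian. Proof: the two 3-cycles `δ₊, δ₋` on `A` are perfect matchings of `E_A` with
  three forks (`exists_three_forks`); their preimages `γ₊, γ₋` are cyclic (`isCycle_of_ne_one`)
  with at least three forks (`card_forks_le_of_labelExponent_eq`); the five non-identity perfect
  matchings of `H` contain every cyclic permutation mixed from `γ₊, γ₋`
  (`isPerfectMatching_of_forall_apply_mem`) and differ pairwise by single cycles
  (`isCycle_inv_mul_of_ne`); so `not_isPfaffianBipartite_of_three_le_forks` applies.

The closer composes this with the restriction to the Little obstruction, the reduction of the
obstruction to the standard shape, and `exists_normalForm_of_isPerfectMatching`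
(`…NormalForm.lean`).
-/

noncomputable section

namespace Summit.ValiantsHypothesis.PolyaContinued

open MvPolynomial Finset Literature.Combinatorics.SimpleGraph Equiv

variable {n : ℕ}

/-- **The core of the label-transfer principle (normal form).** If `H ⊇ diagonal` and a cell
relabelling `φ` with `φ (i, i) = (i, i)` satisfy the label identity
`Σ_{σ ∈ PM(H)} Π_i X (φ (i, σ i)) = PM_E` onto a target `E = {(x, y) : x, y ∈ A} ∪ diagonal` with
`#A = 3`, then `H` is not Pfaffian. (§2 of the paper proof: (F1) + (CS) + (EAR) + (EVEN).)
[folklore] -/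
theorem not_isPfaffianBipartite_of_labelIdentity_of_shape {H E : Finset (Fin n × Fin n)}
    {φ : Fin n × Fin n → Fin n × Fin n} {A : Finset (Fin n)}
    (hid : (∑ σ : Equiv.Perm (Fin n), if (∀ i, (i, σ i) ∈ H) then
        ∏ i, (X (φ (i, σ i)) : MvPolynomial (Fin n × Fin n) ℂ) else 0) =
      perfectMatchingPoly E ℂ)
    (hφ : ∀ i, φ (i, i) = (i, i)) (hHd : ∀ i, (i, i) ∈ H)
    (hE : ∀ x y, (x, y) ∈ E ↔ (x ∈ A ∧ y ∈ A) ∨ x = y) (hA : A.card = 3) :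
    ¬ IsPfaffianBipartite H := by
  classical
  -- target facts
  have hE1 : ∀ π : Perm (Fin n), (∀ i, (i, π i) ∈ E) → π ≠ 1 → π.IsCycle := fun π hπ hne =>
    isCycle_of_support_subset hA ((isPerfectMatching_iff_support_subset hE π).1 hπ) hne
  have hEcyc : ∀ π π' : Perm (Fin n), (∀ i, (i, π i) ∈ E) → (∀ i, (i, π' i) ∈ E) → π ≠ π' →
      (π⁻¹ * π').IsCycle := fun π π' hπ hπ' hne =>
    isCycle_inv_mul_of_support_subset hA ((isPerfectMatching_iff_support_subset hE π).1 hπ)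
      ((isPerfectMatching_iff_support_subset hE π').1 hπ') hne
  obtain ⟨δp, δm, hδp, hδm, hδp1, hδm1, hδpm, h3E⟩ := exists_three_forks hE hA
  -- the lifts `γ₊, γ₋`
  obtain ⟨μ, hμH, hμδ⟩ := exists_preimage_of_labelIdentity hid hδp
  obtain ⟨ν, hνH, hνδ⟩ := exists_preimage_of_labelIdentity hid hδm
  have hμ1 : μ ≠ 1 := by
    rintro rfl
    rw [labelExponent_one hφ] at hμδ
    exact hδp1 (matchingExponent_injective hμδ).symm
  have hν1 : ν ≠ 1 := by
    rintro rfl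
    rw [labelExponent_one hφ] at hνδ
    exact hδm1 (matchingExponent_injective hνδ).symm
  have hμc : μ.IsCycle := isCycle_of_ne_one hid hφ hHd hE1 hμH hμ1
  have hνc : ν.IsCycle := isCycle_of_ne_one hid hφ hHd hE1 hνH hν1
  -- at least three forks lift
  have h3 : 3 ≤ (forks μ ν).card :=
    h3E.trans (card_forks_le_of_labelExponent_eq hφ hμδ hνδ)
  -- the five non-identity perfect matchings of `H`
  set S := Finset.univ.filter fun σ : Perm (Fin n) => (∀ i, (i, σ i) ∈ H) ∧ σ ≠ 1 with hS
  have hS5 : S.card ≤ 5 := by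
    have h1 := card_filter_isPerfectMatching_ne_one hHd
    have h2 := card_filter_isPerfectMatching_eq hid
    rw [card_filter_isPerfectMatching_eq_six hE hA] at h2
    rw [hS]; omega
  have hμS : μ ∈ S := Finset.mem_filter.2 ⟨Finset.mem_univ _, hμH, hμ1⟩
  have hνS : ν ∈ S := Finset.mem_filter.2 ⟨Finset.mem_univ _, hνH, hν1⟩
  have hSc : ∀ c : Perm (Fin n), c.IsCycle → (∀ v, c v = μ v ∨ c v = ν v ∨ c v = v) → c ∈ S :=
    fun c hc hcv => Finset.mem_filter.2 ⟨Finset.mem_univ _,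
      isPerfectMatching_of_forall_apply_mem hHd hμH hνH hcv, hc.ne_one⟩
  have hcyc : ∀ c ∈ S, ∀ c' ∈ S, c ≠ c' → (c⁻¹ * c').IsCycle := fun c hc c' hc' hne =>
    isCycle_inv_mul_of_ne hid hEcyc (Finset.mem_filter.1 hc).2.1 (Finset.mem_filter.1 hc').2.1 hne
  exact not_isPfaffianBipartite_of_three_le_forks hHd hμc hνc hμH hνH S hS5 hμS hνS hSc hcyc h3

end Summit.ValiantsHypothesis.PolyaContinued
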